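import Mathlib
import Summits.ValiantsHypothesis.ValiantsHypothesis.Theorems.LiouvilleSarnakLiouvilleCutRankMultiplicativeBarrier

/-!
# Route LiouvilleSarnak — crux `LiouvilleCutRank` (stmt-ValiantsHypothesis-14775):
# scattered blocks — the ZERO-FILLER hypothesis is FALSE for the twisted character (a barrier; the filler is essential)

`…ScatteredBlocks` (p831263) reduced the OPEN crux `LiouvilleCutRank` to the scattered-block hypothesis SBH₀ with the
ZERO filler («every normalised gap sequence `g` has `rank (λ(1 + Σ_i (2 x_i + y_i) 2^{g i}))_{x,y} ≥ W` for `t ≥ t(W)`»),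
and `…ScatteredBlocksFiller` / `…ScatteredBlocksSelect` (p831341, p831455) to the weaker forms with a FREE filler `H`.
This file shows that SBH₀ is out of reach of the inputs that settled the interleaved prototype (`λ(2m) = -λ(m)`,
`λ(3m) = -λ(m)`, complete multiplicativity, even `λ ≡ -1` on `3 (mod 4)`): the `2`-adically twisted character
`f(2^v M) = (-1)^v χ₄(M)` of `…MultiplicativeBarrier` has all of them, yet

* ★ `exists_completelyMultiplicative_scatteredRank_le_one` — for EVERY block configuration with `g 0 = 0` and all other
  `g i ≥ 4` the zero-filler scattered-block matrix of `f` has rank `≤ 1`: on `n = 1 + d_0 + 16K` (`d_0 = 2x_0 + y_0`) the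
  witness is `(-1)^{x_0} (-1)^{y_0}` (`sum_blocks_split` + the four residues `1, 2, 3, 4 (mod 16)`).

So SBH₀ is FALSE for `f` as soon as the first gap is `≥ 4` (for `λ` it is numerically true with full rank, census of this
hand), and a proof of SBH₀ for `λ` must use a prime `p ≡ 1 (mod 4)` (where `λ(p) = -1 ≠ χ₄(p)`) or non-automaticity —
exactly as for the aligned rung (`…MultiplicativeBarrier`), although the interleaved prototype `g i = 2i` needed neither.
Reading for the line: the free FILLER of p831341 is essential, not cosmetic — with the gap positions filled by ones the
carries run through the gaps and the same witness `f` has scattered-block rank growing like the number of blocks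
(numerics of this hand: rank `t + 1 … t + 2` for `t + 1 ≤ 7` blocks), so the honest residual is the FILLED hypothesis.
Honest framing: a barrier lemma about which inputs cannot suffice; nothing here is a case of the crux; `LiouvilleCutRank`,
`DigitalBilinearLiouville`, `AlgebraicSarnak` stay OPEN; nothing bears on `VP ≠ VNP`.  No definitions (the witness is an
explicit term, as in `…MultiplicativeBarrier`, whose lemmas are reused).
-/

set_option linter.dupNamespace false

noncomputable section

namespace Summit.ValiantsHypothesis.ValiantsHypothesis.Theorems.LiouvilleSarnakLiouvilleCutRank.ScatteredBlocksBarrier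

open Finset

open Summit.ValiantsHypothesis.ValiantsHypothesis.Theorems.LiouvilleSarnakLiouvilleCutRank.MultiplicativeBarrier
  (witness_two_pow_mul_odd exists_eq_two_pow_mul_odd sign_mul_of_odd)

/-- Splitting off the bottom block: if `g 0 = 0` and `g i ≥ 4` for `i ≠ 0`, then
`Σ_i (2 x_i + y_i) 2^{g i} = (2 x_0 + y_0) + 16 · Σ_{i ≥ 1} (2 x_i + y_i) 2^{g i - 4}`. [folklore] -/
theorem sum_blocks_split (t : ℕ) (g : Fin (t + 1) → ℕ) (hg0 : g 0 = 0) (hg : ∀ i : Fin (t + 1), i ≠ 0 → 4 ≤ g i)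
    (x y : Fin (t + 1) → Bool) :
    (∑ i : Fin (t + 1), (2 * (x i).toNat + (y i).toNat) * 2 ^ (g i)) =
      (2 * (x 0).toNat + (y 0).toNat) +
        16 * ∑ i : Fin t, (2 * (x i.succ).toNat + (y i.succ).toNat) * 2 ^ (g i.succ - 4) := by
  rw [Fin.sum_univ_succ, hg0, pow_zero, mul_one, Finset.mul_sum]
  congr 1
  refine Finset.sum_congr rfl (fun i _ => ?_)
  have h4 : 4 ≤ g i.succ := hg i.succ (Fin.succ_ne_zero i)
  rw [show (2 : ℕ) ^ g i.succ = 16 * 2 ^ (g i.succ - 4) by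
    rw [show (16 : ℕ) = 2 ^ 4 by norm_num, ← pow_add]; congr 1; omega]
  ring

/-- ★ **The zero-filler scattered-block hypothesis fails for a completely multiplicative twin of `λ`.**  There is a
completely multiplicative `f : ℕ → {±1}` with `f(2) = -1` and `f(m) = -1` for all `m ≡ 3 (mod 4)` (so `f(3) = -1`,
`f(2m) = -f(m)`, `f(3m) = -f(m)`, `f(4m) = f(m)` — every identity used for the interleaved prototype) such that for EVERY
`t` and every block configuration `g : Fin (t+1) → ℕ` with `g 0 = 0` and `g i ≥ 4` for `i ≠ 0`, the scattered-block matrix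
`(f(1 + Σ_i (2 x_i + y_i) 2^{g i}))_{x, y}` has rank `≤ 1`.  Witness: the `2`-adically twisted character
`f(2^v M) = (-1)^v χ₄(M)` of `…MultiplicativeBarrier`; on `1 + d_0 + 16 K` it equals `(-1)^{x_0} (-1)^{y_0}`
(`d_0 = 2 x_0 + y_0`), an outer product. [this file] -/
theorem exists_completelyMultiplicative_scatteredRank_le_one :
    ∃ f : ℕ → ℤ, (∀ m, 1 ≤ m → f m = 1 ∨ f m = -1) ∧ (∀ a b, 1 ≤ a → 1 ≤ b → f (a * b) = f a * f b) ∧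
      f 2 = -1 ∧ (∀ m, m % 4 = 3 → f m = -1) ∧
      ∀ (t : ℕ) (g : Fin (t + 1) → ℕ), g 0 = 0 → (∀ i : Fin (t + 1), i ≠ 0 → 4 ≤ g i) →
        (Matrix.of fun x y : Fin (t + 1) → Bool =>
          ((f ((∑ i : Fin (t + 1), (2 * (x i).toNat + (y i).toNat) * 2 ^ (g i)) + 1) : ℤ) : ℂ)).rank ≤ 1 := by
  classical
  let f : ℕ → ℤ := fun m =>
    (-1 : ℤ) ^ (m.factorization 2) * (if (m / 2 ^ (m.factorization 2)) % 4 = 3 then -1 else 1)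
  have hf : ∀ v M : ℕ, M % 2 = 1 → f (2 ^ v * M) = (-1 : ℤ) ^ v * (if M % 4 = 3 then -1 else 1) :=
    fun v M hM => witness_two_pow_mul_odd v M hM
  refine ⟨f, fun m hm => ?_, fun a b ha hb => ?_, ?_, fun m hm => ?_, fun t g hg0 hg => ?_⟩
  · obtain ⟨v, M, hM, rfl⟩ := exists_eq_two_pow_mul_odd m (by omega)
    rw [hf v M hM]
    rcases neg_one_pow_eq_or ℤ v with h | h <;> rw [h] <;> split_ifs <;> simp
  · obtain ⟨v, M, hM, rfl⟩ := exists_eq_two_pow_mul_odd a (by omega)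
    obtain ⟨v', M', hM', rfl⟩ := exists_eq_two_pow_mul_odd b (by omega)
    have hMM : (M * M') % 2 = 1 := by
      have := Nat.mul_mod M M' 2; rw [hM, hM'] at this; simpa using this
    rw [show 2 ^ v * M * (2 ^ v' * M') = 2 ^ (v + v') * (M * M') by ring, hf _ _ hMM, hf v M hM,
      hf v' M' hM', sign_mul_of_odd M M' hM hM', pow_add]
    ring
  · have := hf 1 1 (by norm_num)
    simpa using this
  · have h1 : m % 2 = 1 := by omega
    have := hf 0 m h1
    simp only [pow_zero, one_mul, hm, if_true] at this
    simpa using this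
  · -- the scattered-block matrix is the outer product `(-1)^{x_0} ⊗ (-1)^{y_0}`
    set A : Matrix (Fin (t + 1) → Bool) (Fin (t + 1) → Bool) ℂ := Matrix.of fun x y : Fin (t + 1) → Bool =>
        ((f ((∑ i : Fin (t + 1), (2 * (x i).toNat + (y i).toNat) * 2 ^ (g i)) + 1) : ℤ) : ℂ) with hA
    have hentry : ∀ x y : Fin (t + 1) → Bool,
        f ((∑ i : Fin (t + 1), (2 * (x i).toNat + (y i).toNat) * 2 ^ (g i)) + 1) =
          (if x 0 then -1 else 1) * (if y 0 then -1 else 1) := by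
      intro x y
      rw [sum_blocks_split t g hg0 hg x y]
      set K := ∑ i : Fin t, (2 * (x i.succ).toNat + (y i.succ).toNat) * 2 ^ (g i.succ - 4) with hK
      cases hx : x 0 <;> cases hy : y 0
      · -- d_0 = 0 : `1 + 16K`, odd, ≡ 1 (mod 4)
        have h := hf 0 (1 + 16 * K) (by omega)
        simp only [pow_zero, one_mul, show (1 + 16 * K) % 4 = 1 by omega] at h
        simp only [Bool.toNat_false, mul_zero, zero_add, add_zero]
        rw [show 16 * K + 1 = 1 + 16 * K by ring, h]
        simp
      · -- d_0 = 1 : `2 + 16K = 2 (1 + 8K)`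
        have h := hf 1 (1 + 8 * K) (by omega)
        simp only [pow_one, show (1 + 8 * K) % 4 = 1 by omega] at h
        simp only [Bool.toNat_false, Bool.toNat_true, mul_zero, zero_add]
        rw [show 1 + 16 * K + 1 = 2 * (1 + 8 * K) by ring, h]
        simp
      · -- d_0 = 2 : `3 + 16K`, odd, ≡ 3 (mod 4)
        have h := hf 0 (3 + 16 * K) (by omega)
        simp only [pow_zero, one_mul, show (3 + 16 * K) % 4 = 3 by omega, if_true] at h
        simp only [Bool.toNat_false, Bool.toNat_true, mul_one, add_zero]
        rw [show 2 + 16 * K + 1 = 3 + 16 * K by ring, h]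
        simp
      · -- d_0 = 3 : `4 + 16K = 4 (1 + 4K)`
        have h := hf 2 (1 + 4 * K) (by omega)
        simp only [show (1 + 4 * K) % 4 = 1 by omega] at h
        simp only [Bool.toNat_true, mul_one]
        rw [show 2 + 1 + 16 * K + 1 = 2 ^ 2 * (1 + 4 * K) by ring, h]
        norm_num
    have hAeq : A = Matrix.vecMulVec (fun x : Fin (t + 1) → Bool => if x 0 then (-1 : ℂ) else 1)
        (fun y : Fin (t + 1) → Bool => if y 0 then (-1 : ℂ) else 1) := by
      ext x y
      rw [hA, Matrix.of_apply, Matrix.vecMulVec_apply, hentry x y]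
      push_cast
      rfl
    rw [hAeq]
    exact Matrix.rank_vecMulVec_le _ _

end Summit.ValiantsHypothesis.ValiantsHypothesis.Theorems.LiouvilleSarnakLiouvilleCutRank.ScatteredBlocksBarrier

end
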